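import Literature.NumberTheory.Automorphic.RankinSelbergUnfoldedEulerCuspidalPairs
import Literature.NumberTheory.Automorphic.WhittakerCoeffTranslateUnramified
import Literature.NumberTheory.Automorphic.RankinSelbergTorusPairTranslate
import HarnessLib

/-!
# `Ψ(s; W_φ, W̄_{φ'}, Φ) = w_s(τ) · L^{S'}(s, π × \bar{π'}) · Ψ^τ_{S'}(s)` — the Euler factorisation of the
unfolded Rankin–Selberg integral of a pair of cusp forms for an additive character of ARBITRARY conductor
off `S'`

Topic `NumberTheory/Automorphic`; namespace `Literature.NumberTheory.Automorphic`. Proof file (theorems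
only). `rankinSelbergTorusPairIntegralC_whittakerCoeff_eq_partialPairL_mul`
(`RankinSelbergUnfoldedEulerCuspidalPairs`) factors `Ψ(s; W_φ, W̄_{φ'}, Φ)` into
`L^{S'}(s, π × π̄') · Ψ_{S'}(s)` when, off `S'`, `v ∤ 𝔫₀` AND `ψ_v` has conductor `𝒪_v` — for Tate's
character this forces the places dividing the different `𝔡_K` into `S'`. Here the conductor hypothesis
is traded for a translation: let `τ ∈ (𝔸_Kˣ)ⁿ` be a torus element with last entry `1` whose
`v`-component, for every `v ∉ S'`, is a diagonal matrix `diag(d_i)` with constant ratios `a_v` such that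
`ψ_v(a_v ·)` has conductor `𝒪_v` (at `v ∣ 𝔡` the Whittaker shift `diag(ϖ^{-e(n-1)}, …, ϖ^{-e}, 1)`,
at the other places `1`). Then, with `W^τ(g) = W(diag(τ) g)`,

  `Ψ(s; W_φ, W̄_{φ'}, Φ) = w_s(τ) · partialPairL S' α γ̄ s · ∫_{B({v ∉ S'}) × K} W^τ_φ W̄^τ_{φ'} Φ(e_n ·) |det|^s δ_B⁻¹`

for `re s > 1` (`rankinSelbergTorusPairIntegralC_whittakerCoeff_eq_partialPairL_mul_translate`):
substitute `a ↦ τ a` (`rankinSelbergTorusPairIntegralC_eq_torusWeightC_mul_translate`, the factor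
`w_s(τ) = |det τ|^s δ_B(τ)⁻¹`), then run the abstract Euler factorisation
`rankinSelbergTorusPairIntegralC_eq_mul_setIntegral_of_hasProd` for the translated Whittaker functions,
which are unramified torus data at every `v ∉ S'` by the translated Shintani formula
(`exists_isTorusUnramifiedAt_whittakerCoeff_smoothedForm_translate`). This is the unramified computation
of Jacquet–Shalika (1981), §2 / Cogdell (2004), Thm. 3.3 at the places where `ψ_v` is not normalised
("translate the essential vector", Cogdell, §3.1), for the honest global Whittaker coefficients.

## References

* H. Jacquet, J. A. Shalika, Amer. J. Math. 103 (1981), §2 Prop. (2.3), §4 [JacquetShalikaAJM1981].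
* J. W. Cogdell, *Analytic theory of L-functions for GL_n* (2004), §2.3 Thm. 2.2, §3.1, Thm. 3.3
  [CogdellAnalyticTheory2004].
-/

noncomputable section

open MeasureTheory Measure NumberField IsDedekindDomain Matrix Set Filter Finset Topology
open scoped MatrixGroups ENNReal NNReal ComplexConjugate Pointwise
open Literature.RingTheory.SymmetricFunctions.SymmPoly
open Literature.NumberTheory.GaloisRepresentations (ideleGroup localUnits)

namespace Literature.NumberTheory.Automorphic

section Cuspidal

open ValuativeRel

variable {n : ℕ} {K : Type} [Field K] [NumberField K]
  {μ : Measure (AdelicGroupData.gl n K).automorphicQuotient} [(AdelicGroupData.gl n K).IsAutomorphicMeasure μ]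
variable [MeasurableSpace ↥(adelicUnipotent n K)] [BorelSpace ↥(adelicUnipotent n K)]
  [MeasurableConstSMul ↥(rationalUnipotent n K) ↥(adelicUnipotent n K)]
  {ν : Measure ↥(adelicUnipotent n K)} [IsFiniteMeasureOnCompacts ν]
  [SMulInvariantMeasure ↥(rationalUnipotent n K) ↥(adelicUnipotent n K) ν] [ν.IsMulRightInvariant]
  {𝓕 : Set ↥(adelicUnipotent n K)} {ψ : AddChar (AdeleRing (𝓞 K) K) Circle}
variable [MeasurableSpace (ideleGroup K)] [BorelSpace (ideleGroup K)]

-- the house local instances of `RankinSelbergUnfoldedEulerCuspidalPairs` (Borel structures of `GL_n(𝔸_K)` in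
-- both spellings, second countability of `𝔸_Kˣ`); none overrides a Mathlib instance
attribute [local instance] adelicBorel borelSpace_adelic locallyCompactSpace_adelic
  secondCountableTopology_gl_adelic secondCountableTopology_ideleGroup glAdeleBorel borelSpace_glAdele

/-- **`Ψ(s; W_φ, W̄_{φ'}, Φ) = w_s(τ) · L^{S'}(s, α ⊗ γ̄) · Ψ^τ_{S'}(s)` on `re s > 1`, for `ψ` of any
conductor off `S'`.** Let `π`, `π'` be cuspidal automorphic representations of `GL_n(𝔸_K)` (`0 < n`)
with Satake families `α`, `γ` off `S`, `f ∈ π`, `f' ∈ π'`, `η` a continuous compactly supported left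
`K(𝔫₀)`-invariant weight, `φ = invQuot (S_η f)`, `φ' = invQuot (S_η f')`, `W`, `W'` their global
Whittaker coefficients (relatively compact measurable fundamental domain `𝓕`, global character `ψ`),
`Φ = Φ_∞ ⊗ 𝟙_{𝒪̂ⁿ}` with `Φ_∞ ≥ 0` and `g ↦ Φ(e_n g)` measurable, `S' ⊇ S` with `v ∤ 𝔫₀` off `S'`,
and `τ ∈ (𝔸_Kˣ)ⁿ` with last entry `1` such that for every `v ∉ S'` the `v`-component of `diag(τ)` is
`diag(d)` with constant ratios `a` and `ψ_v(a ·)` of conductor `𝒪_v`. For `re s > 1`, if the two real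
unfolded integrals of `W`, `W'` at `re s` are finite, then
`Ψ(s; W, W̄', Φ) = w_s(τ) · partialPairL S' α γ̄ s · ∫_{B({v ∉ S'}) × K} I_s(W(diag τ ·), W̄'(diag τ ·))`.
[cite: CogdellAnalyticTheory2004, §2.3 Thm. 2.2, §3.1 Thm. 3.3] [cite: JacquetShalikaAJM1981, §2 Prop. (2.3), §4] -/
theorem rankinSelbergTorusPairIntegralC_whittakerCoeff_eq_partialPairL_mul_translate (hn : 0 < n)
    (P Q : CuspidalAutomorphicRepGL n K μ) {S : Set (HeightOneSpectrum (𝓞 K))} {α γ : SatakeFamily K}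
    (hα : IsSatakeFamilyOf P S α) (hγ : IsSatakeFamilyOf Q S γ) {𝔫₀ : Ideal (𝓞 K)} (h𝔫₀ : 𝔫₀ ≠ 0)
    {η : (AdelicGroupData.gl n K).Adelic → ℝ} (hη : Continuous η) (hηs : HasCompactSupport η)
    (hηK : ∀ k : (AdelicGroupData.gl n K).Adelic, k ∈ principalCongruenceLevel n K 𝔫₀ →
      ∀ g : (AdelicGroupData.gl n K).Adelic, η (k * g) = η g)
    (f : P.1.toSubmodule) (f' : Q.1.toSubmodule)
    (h𝓕 : IsFundamentalDomain ↥(rationalUnipotent n K) 𝓕 ν) (h𝓕m : MeasurableSet 𝓕)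
    (h𝓕c : IsCompact (closure 𝓕)) (hψ : IsGlobalAddChar K ψ)
    {S' : Set (HeightOneSpectrum (𝓞 K))} (hSS' : S ⊆ S') (hGood : ∀ v ∉ S', ¬ v.asIdeal ∣ 𝔫₀)
    (τ : Fin n → ideleGroup K) (hτ : lastEntry τ = 1)
    (hτψ : ∀ v ∉ S', ∃ (d : Fin n → (v.adicCompletion K)ˣ) (a : (v.adicCompletion K)ˣ),
      localComponent v (glDiagonal n (AdeleRing (𝓞 K) K) τ) = diagonalGL (Fin n) (v.adicCompletion K) d ∧
      (∀ i j : Fin n, (i : ℕ) + 1 = j → (d i : v.adicCompletion K) * ((d j)⁻¹ : (v.adicCompletion K)ˣ) = a) ∧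
      (∀ c ∈ 𝒪[v.adicCompletion K], ψ.adicComponent v (a * c) = 1) ∧
      ∀ ϖ : v.adicCompletion K, Valued.v ϖ = WithZero.exp (-1 : ℤ) →
        ∃ c ∈ 𝒪[v.adicCompletion K], ψ.adicComponent v (a * (ϖ⁻¹ * c)) ≠ 1)
    {x y : HeightOneSpectrum (𝓞 K) → Fin n → ℂ}
    (hx : ∀ v ∉ S', (Finset.univ : Finset (Fin n)).val.map (x v) = α v)
    (hy : ∀ v ∉ S', (Finset.univ : Finset (Fin n)).val.map (y v) = γ v)
    {Φinf : (Fin n → InfiniteAdeleRing K) → ℝ} (hΦinf : ∀ z, 0 ≤ Φinf z)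
    (hΦm : Measurable fun g : GL (Fin n) (AdeleRing (𝓞 K) K) => standardTestFun n K Φinf (lastRow n K g))
    (νA : Measure (Fin n → ideleGroup K)) [νA.IsMulLeftInvariant] [SFinite νA]
    (νK : Measure ↥(maximalCompactAdelic n K)) [SFinite νK] {s : ℂ} (hs : 1 < s.re)
    (hfin : rankinSelbergTorusIntegral n K νA νK
      (whittakerCoeff ν 𝓕 ψ
        (invQuot (AdelicGroupData.gl n K) (smoothedForm η (f : (AdelicGroupData.gl n K).L2 μ))))
      (standardTestFun n K Φinf) s.re ≠ ⊤)
    (hfin' : rankinSelbergTorusIntegral n K νA νK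
      (whittakerCoeff ν 𝓕 ψ
        (invQuot (AdelicGroupData.gl n K) (smoothedForm η (f' : (AdelicGroupData.gl n K).L2 μ))))
      (standardTestFun n K Φinf) s.re ≠ ⊤) :
    rankinSelbergTorusPairIntegralC n K νA νK
        (whittakerCoeff ν 𝓕 ψ
          (invQuot (AdelicGroupData.gl n K) (smoothedForm η (f : (AdelicGroupData.gl n K).L2 μ))))
        (star (whittakerCoeff ν 𝓕 ψ
          (invQuot (AdelicGroupData.gl n K) (smoothedForm η (f' : (AdelicGroupData.gl n K).L2 μ)))))
        (standardTestFun n K Φinf) s =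
      torusWeightC n K s τ * (partialPairL S' α (fun v => (γ v).map conj) s *
        ∫ p in unitBox {v | v ∉ S'} ×ˢ Set.univ, torusPairIntegrandC n K
          (fun g => whittakerCoeff ν 𝓕 ψ
            (invQuot (AdelicGroupData.gl n K) (smoothedForm η (f : (AdelicGroupData.gl n K).L2 μ)))
            (glDiagonal n (AdeleRing (𝓞 K) K) τ * g))
          (fun g => (star (whittakerCoeff ν 𝓕 ψ
            (invQuot (AdelicGroupData.gl n K) (smoothedForm η (f' : (AdelicGroupData.gl n K).L2 μ)))))
            (glDiagonal n (AdeleRing (𝓞 K) K) τ * g))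
          (standardTestFun n K Φinf) s p ∂(νA.prod νK)) := by
  classical
  set φ : GL (Fin n) (AdeleRing (𝓞 K) K) → ℂ :=
    invQuot (AdelicGroupData.gl n K) (smoothedForm η (f : (AdelicGroupData.gl n K).L2 μ)) with hφ
  set φ' : GL (Fin n) (AdeleRing (𝓞 K) K) → ℂ :=
    invQuot (AdelicGroupData.gl n K) (smoothedForm η (f' : (AdelicGroupData.gl n K).L2 μ)) with hφ'
  set W : GL (Fin n) (AdeleRing (𝓞 K) K) → ℂ := whittakerCoeff ν 𝓕 ψ φ with hWdef
  set W' : GL (Fin n) (AdeleRing (𝓞 K) K) → ℂ := whittakerCoeff ν 𝓕 ψ φ' with hW'def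
  set Φ : (Fin n → AdeleRing (𝓞 K) K) → ℝ := standardTestFun n K Φinf with hΦdef
  set D : GL (Fin n) (AdeleRing (𝓞 K) K) := glDiagonal n (AdeleRing (𝓞 K) K) τ with hD
  -- substitute `a ↦ τ a`
  rw [rankinSelbergTorusPairIntegralC_eq_torusWeightC_mul_translate νA νK τ hτ s]
  congr 1
  -- the translated Whittaker functions are unramified torus data off `S'`
  have hex : ∀ v ∉ S', ∃ ϖ : (v.adicCompletion K)ˣ, IsTorusUnramifiedAt n K (fun g => W (D * g)) v ϖ (x v) :=
    fun v hv => by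
      obtain ⟨d, a, hT, hd, hψa, hψa'⟩ := hτψ v hv
      exact exists_isTorusUnramifiedAt_whittakerCoeff_smoothedForm_translate P hα h𝔫₀ (fun h => hv (hSS' h))
        (hGood v hv) hη hηs hηK f (hx v hv) h𝓕 h𝓕c hψ hT hd hψa hψa'
  have hex' : ∀ v ∉ S', ∃ ϖ : (v.adicCompletion K)ˣ, IsTorusUnramifiedAt n K (fun g => W' (D * g)) v ϖ (y v) :=
    fun v hv => by
      obtain ⟨d, a, hT, hd, hψa, hψa'⟩ := hτψ v hv
      exact exists_isTorusUnramifiedAt_whittakerCoeff_smoothedForm_translate Q hγ h𝔫₀ (fun h => hv (hSS' h))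
        (hGood v hv) hη hηs hηK f' (hy v hv) h𝓕 h𝓕c hψ hT hd hψa hψa'
  let ϖ : ∀ v : HeightOneSpectrum (𝓞 K), (v.adicCompletion K)ˣ := fun v =>
    if hv : v ∉ S' then Classical.choose (hex v hv) else 1
  have hW : ∀ v ∉ S', IsTorusUnramifiedAt n K (fun g => W (D * g)) v (ϖ v) (x v) := fun v hv => by
    simp only [ϖ, dif_pos hv]
    exact Classical.choose_spec (hex v hv)
  have hW' : ∀ v ∉ S', IsTorusUnramifiedAt n K (fun g => (star W') (D * g)) v (ϖ v) (star (y v)) := fun v hv => by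
    obtain ⟨ϖ', hϖ'⟩ := hex' v hv
    exact (hϖ'.of_valued_eq (hW v hv).valued_eq).star
  -- central invariance of `‖W^τ‖`
  obtain ⟨ω, hu, -, -, -, -, hcl⟩ := P.exists_centralCharacter_smoothedForm
  have hWZ0 : ∀ (z : ideleGroup K) (g : GL (Fin n) (AdeleRing (𝓞 K) K)),
      ‖W (Matrix.GeneralLinearGroup.scalar (Fin n) z * g)‖ = ‖W g‖ := fun z g => by
    rw [hWdef, whittakerCoeff_scalar_mul (fun g' => hcl η f z g') g, norm_mul, hu z, one_mul]
  have hWZ : ∀ (z : ideleGroup K) (g : GL (Fin n) (AdeleRing (𝓞 K) K)),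
      ‖W (D * (Matrix.GeneralLinearGroup.scalar (Fin n) z * g))‖ = ‖W (D * g)‖ :=
    norm_translate_scalar_mul τ hWZ0
  -- the test function
  have hΦ0 : ∀ y, 0 ≤ Φ y := standardTestFun_nonneg hΦinf
  have hΦv : ∀ v ∉ S', ∀ y : Fin n → AdeleRing (𝓞 K) K, Φ y ≠ 0 → ∀ j, Valued.v ((y j).2 v) ≤ 1 :=
    fun v _ y hy j => standardTestFun_ne_zero_valued_le_one Φinf hy j
  -- integrability of the complex pair integrand, then of the translated one
  have hWc : Continuous W := continuous_whittakerCoeff h𝓕m h𝓕c hψ.continuous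
    (continuous_invQuot_smoothedForm hη hηs _)
  have hW'c : Continuous W' := continuous_whittakerCoeff h𝓕m h𝓕c hψ.continuous
    (continuous_invQuot_smoothedForm hη hηs _)
  have hW'sc : Continuous (star W') := hW'c.star
  haveI : SecondCountableTopology (GL (Fin n) (AdeleRing (𝓞 K) K)) :=
    secondCountableTopology_generalLinearGroup_adeleRing K (Fin n)
  haveI : SecondCountableTopology (AdelicGroupData.gl n K).Adelic :=
    secondCountableTopology_generalLinearGroup_adeleRing K (Fin n)
  haveI : SecondCountableTopology ↥(maximalCompactAdelic n K) := TopologicalSpace.Subtype.secondCountableTopology _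
  have hpt : Measurable (torusPoint n K) := continuous_torusPoint.measurable
  have hmeas : Measurable (torusPairIntegrandC n K W (star W') Φ s) :=
    measurable_torusPairIntegrandC (hWc.measurable.comp hpt) (hW'sc.measurable.comp hpt) (hΦm.comp hpt) s
  have hfin'' : rankinSelbergTorusIntegral n K νA νK (star W') Φ s.re ≠ ⊤ := by
    rw [rankinSelbergTorusIntegral_star]; exact hfin'
  have hint0 : Integrable (torusPairIntegrandC n K W (star W') Φ s) (νA.prod νK) :=
    integrable_torusPairIntegrandC νA νK hΦ0 hmeas.aestronglyMeasurable (measurable_torusIntegrand hWc hΦm s.re)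
      (measurable_torusIntegrand hW'sc hΦm s.re) hfin hfin''
  have hint : Integrable (torusPairIntegrandC n K (fun g => W (D * g)) (fun g => (star W') (D * g)) Φ s)
      (νA.prod νK) :=
    integrable_torusPairIntegrandC_translate νA νK τ hτ hint0
  -- finiteness of the real torus sums at `re s` from the Satake bound
  have hSv : ∀ v ∉ S', v ∉ S := fun v hv h => hv (hSS' h)
  have hy' : ∀ v ∉ S', (Finset.univ : Finset (Fin n)).val.map (star (y v)) = (γ v).map conj := fun v hv => by
    rw [← hy v hv, Multiset.map_map]
    rfl
  have hTx : ∀ v ∉ S', schurSelfSum (x v) ((v.residueCard : ℝ) ^ (-s.re)) ≠ ⊤ := fun v hv =>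
    schurSelfSum_ne_top_of_norm_satakeParameter_le_sqrt norm_satakeParameter_le_sqrt_holds P hα
      (hSv v hv) (x v) (hx v hv) hs
  have hTy : ∀ v ∉ S', schurSelfSum (star (y v)) ((v.residueCard : ℝ) ^ (-s.re)) ≠ ⊤ := fun v hv =>
    schurSelfSum_ne_top_of_norm_satakeParameter_le_sqrt norm_satakeParameter_le_sqrt_holds Q.conj hγ.conj
      (hSv v hv) (star (y v)) (hy' v hv) hs
  -- the Euler product of the local factors
  have hL := hasProd_partialPairL JacquetShalika1981_multipliable_partialPairL_holds P Q.conj (hα.mono hSS')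
    (hγ.mono hSS').conj hs
  exact rankinSelbergTorusPairIntegralC_eq_mul_setIntegral_of_hasProd νA νK hn hW hW' hWZ
    (fun v _ => isLastRowSphericalAt_standardTestFun Φinf v) hΦv hΦ0 hint hTx hTy hx hy' hL

end Cuspidal

end Literature.NumberTheory.Automorphic
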